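import Summits.HodgeConjecture.HodgeConjecture.Theses.PadicSemiregularLift
import Literature.AlgebraicGeometry.Motives.CrystallineRealization
import Literature.AlgebraicGeometry.Motives.SupersingularAbelianVariety
import Literature.AlgebraicGeometry.HodgeTheory.AlgebraicClasses
import Literature.AlgebraicGeometry.HodgeTheory.RationalHodgeClasses

/-!
# `HodgeAbelianVarieties` (stmt-HodgeConjecture-1333) · Negative · typing of the line
`inner-form-invariant-seeds` (drefute pass on its four registered stubs)

Kernel-checked, structure-free lemmas behind the drefute notes on the skeleton
`Cruxes/HodgeAbelianVarieties/Lines/inner-form-invariant-seeds.lean` (sha `6b271886427a`, stubs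
`stub_hodgeGenericAnchors`, `stub_classicalPackage`, `stub_innerFormSpan`, `stub_rationalPVHC`).
They are phrased over the raw data of an anchor — a crystalline realization `C`, a model `𝒴/W(k)`,
an `ι`-semilinear period map `cmp` into a complex vector space — so that the lead can instantiate
them at `D : Anchor n X` by `D.C`, `D.model`, `D.cmp`, `hG.periodSpan`, … without importing the
skeleton.

1. `span_cmp_bo_tateClasses_eq_top`, `span_tateClasses_eq_top_of_supersingular`: at a
   SUPERSINGULAR special fibre the Tate classes `T = {φ x = pʳ x}` `K`-span `H²ʳ` (Lenstra–Zarhin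
   named fact + `algebraicLattice ≤ T`), hence `cmp ∘ bo (T)` `ℂ`-spans `H²ʳ(X(ℂ); ℂ)` as soon as
   `cmp` does (`IsGenuine.periodSpan`). So the field `IsGenuine.hodgeAreTate` ("Hodge ⇒ crystalline
   Tate", meant to carry Blasius–Ogus–Kisin `φ`-exactness of Hodge classes) holds for EVERY class,
   Hodge or not: the typed interface does not contain the input that step (i)/(iv) of the paper
   proof of `stub_innerFormSpan` uses.
2. `mem_span_anchored_of_mem_span_cmp_ratAlgebraic`: SPANNING (`Anchor.SpansHodge`) follows from
   the cycle part of HC for `X` + DESCENT of complex algebraic classes to `K`-rational de Rham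
   cycle classes + specialization of cycles at `𝒴`; with the skeleton's `cyclePart_of_spansHodge`
   this makes `stub_innerFormSpan` at a genuine anchor with descent EQUIVALENT to the cycle part of
   HC for the anchored fibre modulo `RationalPVHCFor` — its truth value adds nothing to the crux;
   only its claimed provability-now (Kisin's inner form) is content, and that is not expressible
   over `IsGenuine`.
3. `span_anchored_le_span_tate`: conversely the conclusion of SPANNING implies the conclusion of
   `hodgeAreTate` (`U_Hdg ⊆ ratAlgebraicClasses ⊆ T`).
4. `bo_mem_span_ratAlgebraic_of_dim_zero`: the `d = 0` end of `stub_rationalPVHC`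
   (`RationalPVHCFor C 𝒴` for a model of relative dimension `0`) holds for EVERY `C`, with none of
   the four hypotheses — the only regime in which a model is constructible today is harmless.

No statement here asserts a Theses declaration; nothing is refuted (drefute outcome: 0 stub-false).
-/

set_option linter.dupNamespace false

noncomputable section

open CategoryTheory AlgebraicGeometry
open scoped Isocrystal

namespace Summit.HodgeConjecture.HodgeConjecture.Theorems.HodgeAbelianVarieties.Negative.InnerFormSeeds

open Literature.AlgebraicGeometry Literature.AlgebraicGeometry.Motives
  Literature.AlgebraicGeometry.Motives.WittScheme

variable {p : ℕ} [Fact p.Prime] {k : Type} [Field k] [CharP k p] [PerfectRing k p]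

/-! ## 1. `hodgeAreTate` is Hodge-free at supersingular special fibres -/

/-- Images of a `K`-spanning set under a surjective `K`-linear map followed by an `ι`-semilinear
map whose range `ℂ`-spans the target again `ℂ`-span the target. [folklore] -/
theorem span_image_comp_eq_top {K : Type*} [Field K] {H M V : Type*} [AddCommGroup H] [Module K H]
    [AddCommGroup M] [Module K M] [AddCommGroup V] [Module ℂ V] {ι : K →+* ℂ}
    (bo : H →ₗ[K] M) (hbo : Function.Surjective bo) (cmp : M →ₛₗ[ι] V)
    (hspan : Submodule.span ℂ (Set.range cmp) = ⊤) (T : Set H)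
    (hT : Submodule.span K T = ⊤) :
    Submodule.span ℂ ((fun u => cmp (bo u)) '' T) = ⊤ := by
  refine eq_top_iff.2 ?_
  rw [← hspan, Submodule.span_le]
  rintro _ ⟨x, rfl⟩
  -- `x ∈ K · bo(T)` since `bo` is onto and `T` spans
  have hx : x ∈ Submodule.span K (bo '' T) := by
    rw [← Submodule.map_span, hT, Submodule.map_top, LinearMap.range_eq_top.2 hbo]
    trivial
  -- push the `K`-combination through the semilinear `cmp`
  induction hx using Submodule.span_induction with
  | mem y hy =>
      obtain ⟨u, hu, rfl⟩ := hy
      exact Submodule.subset_span ⟨u, hu, rfl⟩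
  | zero => simp
  | add y z _ _ hy hz => simpa [map_add] using add_mem hy hz
  | smul a y _ hy => simpa [LinearMap.map_smulₛₗ] using Submodule.smul_mem _ (ι a) hy

/-- **On a supersingular abelian variety over an algebraically closed field the Tate classes
`K`-span `H²ʳ`** (for any crystalline realization `C`): all of `H²ʳ` is the `K`-span of algebraic
classes (Lenstra–Zarhin 1993 §1, the tree's named fact
`LenstraZarhin1993_supersingular_lefschetzClasses_eq_top`, consumed as a hypothesis on
`C.toWeilCohomology`), and integral algebraic classes are `φ = pʳ` eigenvectors
(`algebraicLattice_le_tateClasses`, Ogus 1982 §4). [cite: LenstraZarhin1993, §1 pp. 179–180] -/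
theorem span_tateClasses_eq_top_of_supersingular [IsAlgClosed k] (C : CrystallineRealization p k)
    (A₀ : AbelianVariety k) (hss : A₀.IsSupersingular)
    (hLZ : LenstraZarhin1993_supersingular_lefschetzClasses_eq_top C.toWeilCohomology A₀) (r : ℕ) :
    Submodule.span K(p, k) (C.tateClasses A₀.X r : Set (C.obj A₀.X (2 * r))) = ⊤ := by
  have htop := hLZ.algebraicClasses_eq_top hss r
  refine eq_top_iff.2 ?_
  change ⊤ ≤ Submodule.span K(p, k) (C.tateClasses A₀.X r : Set (C.obj A₀.X (2 * r)))
  rw [← htop]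
  exact Submodule.span_mono
    (C.algebraicLattice_le_tateClasses AbelianVariety.isSmoothProjective_holds r)

/-- **`IsGenuine.hodgeAreTate` restated without Hodge classes.** For a crystalline realization `C`,
a smooth proper model `𝒴/W(k)` whose special fibre is (the scheme of) a supersingular abelian
variety `A₀`, and ANY `ι`-semilinear map `cmp : H²ʳ_dR(Y_K/K) → V` whose range `ℂ`-spans `V`
(the field `IsGenuine.periodSpan`), EVERY `c : V` lies in the `ℂ`-span of `cmp ∘ bo (T)`,
`T` the `φ = pʳ` Tate classes of the special fibre — the conclusion of `IsGenuine.hodgeAreTate` for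
all classes, rational `(r,r)` or not. Inputs: `bo` bijective (Berthelot–Ogus, `C.bijective_bo`),
`T` `K`-spans (previous theorem). So at the anchors of the line the "Hodge ⇒ crystalline Tate" field
carries no Hodge-theoretic information; the `φ`-EXACTNESS `bo⁻¹ (cmp⁻¹ c) ∈ T` of a Hodge class
(Blasius 1994 / Kisin 2010 (1.3.6)), which the inner-form argument uses, is a strictly sharper
statement absent from the interface. [cite: LenstraZarhin1993, §1 pp. 179–180] -/
theorem span_cmp_bo_tateClasses_eq_top [IsAlgClosed k] (C : CrystallineRealization p k) {d : ℕ}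
    {𝒴 : SchemeOver (WittVector p k)} (h𝒴 : IsSmoothProperModel d 𝒴) (A₀ : AbelianVariety k)
    (hA : A₀.X = specialFibre 𝒴) (hss : A₀.IsSupersingular)
    (hLZ : LenstraZarhin1993_supersingular_lefschetzClasses_eq_top C.toWeilCohomology A₀)
    {V : Type*} [AddCommGroup V] [Module ℂ V] {ι : K(p, k) →+* ℂ} (r : ℕ)
    (cmp : C.dR.obj (genericFibre 𝒴) (2 * r) →ₛₗ[ι] V)
    (hspan : Submodule.span ℂ (Set.range cmp) = ⊤) :
    Submodule.span ℂ ((fun u => cmp (C.bo 𝒴 (2 * r) u)) ''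
      (C.tateClasses (specialFibre 𝒴) r : Set (C.obj (specialFibre 𝒴) (2 * r)))) = ⊤ := by
  have hT := span_tateClasses_eq_top_of_supersingular C A₀ hss hLZ r
  rw [hA] at hT
  exact span_image_comp_eq_top (C.bo 𝒴 (2 * r)) (C.bijective_bo h𝒴 (2 * r)).2 cmp hspan _ hT

/-- Pointwise form of `span_cmp_bo_tateClasses_eq_top`: the literal conclusion of
`IsGenuine.hodgeAreTate` holds for every class `c`, with no rationality or Hodge-type hypothesis.
[cite: LenstraZarhin1993, §1 pp. 179–180] -/
theorem mem_span_cmp_bo_tateClasses [IsAlgClosed k] (C : CrystallineRealization p k) {d : ℕ}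
    {𝒴 : SchemeOver (WittVector p k)} (h𝒴 : IsSmoothProperModel d 𝒴) (A₀ : AbelianVariety k)
    (hA : A₀.X = specialFibre 𝒴) (hss : A₀.IsSupersingular)
    (hLZ : LenstraZarhin1993_supersingular_lefschetzClasses_eq_top C.toWeilCohomology A₀)
    {V : Type*} [AddCommGroup V] [Module ℂ V] {ι : K(p, k) →+* ℂ} (r : ℕ)
    (cmp : C.dR.obj (genericFibre 𝒴) (2 * r) →ₛₗ[ι] V)
    (hspan : Submodule.span ℂ (Set.range cmp) = ⊤) (c : V) :
    c ∈ Submodule.span ℂ ((fun u => cmp (C.bo 𝒴 (2 * r) u)) ''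
      (C.tateClasses (specialFibre 𝒴) r : Set (C.obj (specialFibre 𝒴) (2 * r)))) := by
  rw [span_cmp_bo_tateClasses_eq_top C h𝒴 A₀ hA hss hLZ r cmp hspan]
  trivial

/-! ## 2. SPANNING from the Hodge conjecture for the fibre + descent + specialization -/

/-- **`U_Hdg` absorbs the `K`-rational algebraic classes of the generic fibre.** If every rational
algebraic de Rham class of `Y_K` specialises (is `bo` of a rational algebraic class of the special
fibre — `IsGenuine.specialization` at `𝒴`), then every `c` in the `ℂ`-span of `cmp` of those
classes lies in the `ℂ`-span of `cmp ∘ bo (U_Hdg)`, `U_Hdg = {u ∈ A(X_k)_ℚ | bo u ∈ Fʳ}`: algebraic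
de Rham classes lie in `Fʳ` (`DeRhamRealization.mem_fil_of_mem_algebraicClasses`). [folklore] -/
theorem mem_span_anchored_of_mem_span_cmp_ratAlgebraic (C : CrystallineRealization p k) {d : ℕ}
    {𝒴 : SchemeOver (WittVector p k)} (h𝒴 : IsSmoothProperModel d 𝒴) (r : ℕ)
    (hspec : ∀ x : C.dR.obj (genericFibre 𝒴) (2 * r),
      x ∈ C.dR.ratAlgebraicClasses (genericFibre 𝒴) r →
        ∃ u ∈ C.ratAlgebraicClasses (specialFibre 𝒴) r, C.bo 𝒴 (2 * r) u = x)
    {V : Type*} [AddCommGroup V] [Module ℂ V] {ι : K(p, k) →+* ℂ}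
    (cmp : C.dR.obj (genericFibre 𝒴) (2 * r) →ₛₗ[ι] V) (c : V)
    (hc : c ∈ Submodule.span ℂ (cmp ''
      (C.dR.ratAlgebraicClasses (genericFibre 𝒴) r : Set (C.dR.obj (genericFibre 𝒴) (2 * r))))) :
    c ∈ Submodule.span ℂ ((fun u => cmp (C.bo 𝒴 (2 * r) u)) ''
      {u | u ∈ C.ratAlgebraicClasses (specialFibre 𝒴) r ∧
        C.bo 𝒴 (2 * r) u ∈ C.dR.fil (2 * r) r}) := by
  refine Submodule.span_mono ?_ hc
  rintro _ ⟨x, hx, rfl⟩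
  obtain ⟨u, hu, rfl⟩ := hspec x hx
  refine ⟨u, ⟨hu, ?_⟩, rfl⟩
  exact C.dR.mem_fil_of_mem_algebraicClasses h𝒴.isSmoothProjective_genericFibre r
    (C.dR.ratAlgebraicClasses_le_algebraicClasses _ r hx)

open Literature.AlgebraicGeometry.HodgeTheory in
/-- **SPANNING is the cycle part of HC for the fibre, read through descent and specialization.**
For a complex `n`-fold `X` with period maps `cmp i : Hⁱ_dR(Y_K/K) → Hⁱ(X(ℂ); ℂ)` from the generic
fibre of a smooth proper `𝒴/W(k)`: if (a) every complex algebraic class of `X` lies in the `ℂ`-span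
of `cmp` of `K`-RATIONAL de Rham cycle classes (DESCENT — true for the classical package by
Néron–Ogg–Shafarevich unramifiedness, but NOT a field of `IsGenuine`), (b) cycles specialise at `𝒴`,
and (c) the cycle part of the Hodge conjecture holds for `X`, then every rational `(r,r)`-class of
`X` is in the `ℂ`-span of `cmp ∘ bo (U_Hdg)` — verbatim the conclusion `Anchor.SpansHodge` of
`stub_innerFormSpan`. With the skeleton's `Anchor.cyclePart_of_spansHodge` (SPANNING + rational
pVHC ⇒ cycle part of HC) the stub is, anchor by anchor and modulo `RationalPVHCFor` + descent,
EQUIVALENT to the cycle part of HC for the anchored fibre. [folklore] -/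
theorem spansHodge_of_cyclePart_of_descent (C : CrystallineRealization p k) {d : ℕ}
    {𝒴 : SchemeOver (WittVector p k)} (h𝒴 : IsSmoothProperModel d 𝒴)
    (hspec : ∀ (r : ℕ) (x : C.dR.obj (genericFibre 𝒴) (2 * r)),
      x ∈ C.dR.ratAlgebraicClasses (genericFibre 𝒴) r →
        ∃ u ∈ C.ratAlgebraicClasses (specialFibre 𝒴) r, C.bo 𝒴 (2 * r) u = x)
    {n : ℕ} {X : SchemeOver ℂ} {ι : K(p, k) →+* ℂ}
    (cmp : ∀ i : ℕ, C.dR.obj (genericFibre 𝒴) i →ₛₗ[ι] complexBetti X i)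
    (hdesc : ∀ r : ℕ, algebraicClasses X r ≤ Submodule.span ℂ (cmp (2 * r) ''
      (C.dR.ratAlgebraicClasses (genericFibre 𝒴) r : Set (C.dR.obj (genericFibre 𝒴) (2 * r)))))
    (hHC : ∀ (r : ℕ) (c : complexBetti X (2 * r)), IsRationalClass c →
      IsOfHodgeType n X (2 * r) r r c → c ∈ algebraicClasses X r)
    (r : ℕ) (c : complexBetti X (2 * r)) (hc : IsRationalClass c)
    (hH : IsOfHodgeType n X (2 * r) r r c) :
    c ∈ Submodule.span ℂ ((fun u => cmp (2 * r) (C.bo 𝒴 (2 * r) u)) ''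
      {u | u ∈ C.ratAlgebraicClasses (specialFibre 𝒴) r ∧
        C.bo 𝒴 (2 * r) u ∈ C.dR.fil (2 * r) r}) :=
  mem_span_anchored_of_mem_span_cmp_ratAlgebraic C h𝒴 r (hspec r) (cmp (2 * r)) c
    (hdesc r (hHC r c hc hH))

/-! ## 3. SPANNING implies `hodgeAreTate` -/

/-- `U_Hdg ⊆ A(X_k)_ℚ ⊆ T`: the `ℂ`-span of `cmp ∘ bo (U_Hdg)` is contained in the `ℂ`-span of
`cmp ∘ bo (T)` (`ratAlgebraicClasses_le_tateClasses`, Ogus 1982 §4, on the smooth projective special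
fibre). So the conclusion of `stub_innerFormSpan` implies the hypothesis field
`IsGenuine.hodgeAreTate` it is supposed to be proved from. [cite: Ogus1982, §4] -/
theorem span_anchored_le_span_tate (C : CrystallineRealization p k) {d : ℕ}
    {𝒴 : SchemeOver (WittVector p k)} (h𝒴 : IsSmoothProperModel d 𝒴) (r : ℕ)
    {V : Type*} [AddCommGroup V] [Module ℂ V] {ι : K(p, k) →+* ℂ}
    (cmp : C.dR.obj (genericFibre 𝒴) (2 * r) →ₛₗ[ι] V) :
    Submodule.span ℂ ((fun u => cmp (C.bo 𝒴 (2 * r) u)) ''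
      {u | u ∈ C.ratAlgebraicClasses (specialFibre 𝒴) r ∧
        C.bo 𝒴 (2 * r) u ∈ C.dR.fil (2 * r) r}) ≤
    Submodule.span ℂ ((fun u => cmp (C.bo 𝒴 (2 * r) u)) ''
      (C.tateClasses (specialFibre 𝒴) r : Set (C.obj (specialFibre 𝒴) (2 * r)))) := by
  refine Submodule.span_mono (Set.image_mono ?_)
  intro u hu
  exact C.ratAlgebraicClasses_le_tateClasses h𝒴.isSmoothProjective_specialFibre r hu.1

/-! ## 4. The `d = 0` end of `stub_rationalPVHC` holds for every `C` -/

/-- The unit of a Weil cohomology theory is nonzero on a smooth projective `X` (`1 ∪ a = a` and the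
trace `H²ⁿ(X) → K` is onto). (Also `one_ne_zero_of_isSmoothProjective` for the crystalline side in
`Motives/CrystallineRiemannRoch`; restated for an arbitrary `WeilCohomology` to apply it to `C.dR`.)
[cite: Kleiman1968, §1.2 (A)] -/
theorem weil_one_ne_zero {k' : Type} {K : Type*} [Field k'] [Field K] [CharZero K] (W : WeilCohomology k' K)
    {n : ℕ} {X : SchemeOver k'} (hX : IsSmoothProjective n X) : W.one X ≠ 0 := by
  intro h0
  obtain ⟨a, ha⟩ := (W.bijective_trace hX).2 1
  have : a = 0 := by rw [← W.one_cup hX (Nat.zero_add _) a, h0, LinearMap.map_zero₂]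
  rw [this, map_zero] at ha
  exact zero_ne_one ha

/-- On a smooth projective `X`, `H⁰(X)` is the `K`-span of the RATIONAL algebraic classes of
codimension `0` (it is the line `K · 1`, and `1 = cl[X]` is algebraic). [cite: Kleiman1968, §1.2 (A), (C)] -/
theorem span_ratAlgebraicClasses_zero_eq_top {k' : Type} {K : Type*} [Field k'] [Field K] [CharZero K]
    (W : WeilCohomology k' K) {n : ℕ} {X : SchemeOver k'} (hX : IsSmoothProjective n X) :
    Submodule.span K (W.ratAlgebraicClasses X 0 : Set (W.obj X (2 * 0))) = ⊤ := by
  haveI : IrreducibleSpace X.left := hX.irreducibleSpace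
  have hη : Order.coheight (genericPoint X.left) = 0 :=
    coheight_eq_zero_of_isGenericPoint_univ (genericPoint_spec X.left)
  have hone : W.one X ∈ W.ratAlgebraicClasses X 0 := by
    rw [← W.cycleClass_of_coheight_eq_zero hX _ hη]
    exact W.algebraicLattice_le_ratAlgebraicClasses X 0 (W.cycleClass_mem_algebraicLattice X 0 hη)
  have h1 : Submodule.span K ({W.one X} : Set (W.obj X (2 * 0))) = ⊤ :=
    (finrank_eq_one_iff_of_nonzero _ (weil_one_ne_zero W hX)).1 (W.finrank_obj_zero hX)
  refine eq_top_iff.2 ?_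
  rw [← h1]
  exact Submodule.span_mono (Set.singleton_subset_iff.2 hone)

/-- **The relative-dimension-`0` instance of `stub_rationalPVHC` is true for EVERY crystalline
realization**, with none of its four hypotheses (`BerthelotOgusLineBundleLifting`,
`SpecializationOfCycles`, `DivisorClassesAreChern`, `RationallyLefschetz`) and no supersingularity:
for a smooth proper model `𝒴/W(k)` of relative dimension `0`, every class `u` of the special fibre
has `bo u ∈ K · A⁰(Y_K)_ℚ` in degree `0` (`H⁰_dR(Y_K)` is the line through `1 = cl[Y_K]`) and `u = 0` in
degree `2r ≥ 2 > 2·0` (vanishing axiom). This is verbatim `RationalPVHCFor C 𝒴` of the skeleton, so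
the only regime in which a `PadicModel` is constructible in the tree today (a point) cannot kill
STUB 4. [cite: Kleiman1968, §1.2 (A), (C)] -/
theorem bo_mem_span_ratAlgebraic_of_dim_zero (C : CrystallineRealization p k)
    {𝒴 : SchemeOver (WittVector p k)} (h𝒴 : IsSmoothProperModel 0 𝒴) (r : ℕ)
    (u : C.obj (specialFibre 𝒴) (2 * r)) :
    C.bo 𝒴 (2 * r) u ∈ Submodule.span K(p, k)
      (C.dR.ratAlgebraicClasses (genericFibre 𝒴) r :
        Set (C.dR.obj (genericFibre 𝒴) (2 * r))) := by
  cases r with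
  | zero =>
      rw [span_ratAlgebraicClasses_zero_eq_top C.dR.toWeilCohomology
        h𝒴.isSmoothProjective_genericFibre]
      trivial
  | succ j =>
      haveI : Subsingleton (C.obj (specialFibre 𝒴) (2 * (j + 1))) :=
        C.subsingleton_obj h𝒴.isSmoothProjective_specialFibre (by omega)
      rw [Subsingleton.elim u 0, map_zero]
      exact Submodule.zero_mem _

end Summit.HodgeConjecture.HodgeConjecture.Theorems.HodgeAbelianVarieties.Negative.InnerFormSeeds

end
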